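import Summits.ABC.IUTFork.Cor312ThetaSideAssemblyM
import Literature.IUT.LogVolume.TensorPacketOrbitVolume
import Literature.IUT.LogVolume.TensorPacketOrbitContent
import Literature.IUT.LogVolume.TensorPacketStepV
import HarnessLib

/-!
# [IUTchIII] Corollary 3.12, G1-Θ unit P6-instB: the CONTENT FAMILY of the slot unions at the M-level presentation and the
# identification `Σ_{v⃗} Pr(v⃗)·(−m(v⃗)·log p + log μ̄(hull(log_p R_{v⃗}^×))) = orbitSumM` (pure packet algebra)

PROOF-ONLY support file (D-0012; no definitions, no `Prop` facts) of the abc-iut cell (R2 S-chain team, seat abc-iut-s2-p7,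
TARGET #2 `hΘ`; G1-Θ unit «P6-instB» of abc-iut-w5-d166's LAST-MILE SPLIT 10:39:44Z for
`HOME/staging/w5/w5-d166/g4/G1-THETA-SHAPES.md`). TAKES NO SIDE on [IUTchIII] Cor. 3.12.

[IUTchIV] Thm. 1.10 Step (v) (kurims Apr-2020 manuscript p. 27–28) measures the hull of the (Ind2)-orbit of the slots of the
Θ-pilot region by the inclusions `⋯ ⊆ p^{⌊λ−d_I−a_I⌋}·log_p(R_I^×) ⊆ ⋯`; Dupuy–Hilado (arXiv:2004.13228) §4.9/§4.12 phrase the same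
through `Aut_{ℚ_p}(V : I)` and "the smallest polydisc". abc-iut-w5-d180 / abc-iut-c312-3 made it EXACT at the packet level
(`TensorPacketOrbitContent`/`…OrbitVolume`/`…OrbitSpan`: every nonzero bounded region `M` has a CONTENT `m` — `M ⊆ p^m·log_p(R_I^×)`,
`M ⊄ p^{m+1}·log_p(R_I^×)` — and `hull(⋃_{g ∈ Ind2} g·M) = hull(p^m·log_p(R_I^×))`, of log-volume `−m·log p + log μ̄(hull(log_p(R_I^×)))`).
THIS FILE supplies the two packet-algebra inputs of unit P6 that do not depend on any `Cor312.Setting`: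

* §1 GENERIC over a tuple of MLF-class fields `k : I → Type` and a slot family `x : Π_a k_a` of NONZERO elements:
  `exists_content_slotUnion` (the slot union `⋃_a ι_a(x_a)·(R_I)^∼` has a content), `packetLogμ_packetHull_orbit_slotUnion_eq`
  (log-volume of the orbit hull in terms of the content), **`content_slotUnion_perm`** ((Ind1) symmetry: the slot union of the
  permuted family `(k∘σ, x∘σ)` has the SAME content — abc-iut-S8 `image_permAlgEquiv_iota_smul_normalizedPacket` +
  `image_logPacket_perm` + `content_unique`);
* §2 at the M-LEVEL presentation of abc-iut-w5-d166 (unit P1 `kOfM`, p433804) with abc-iut-w5-d033's Θ-ideles `tThetaM` (unit P4a,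
  p436273) of idele data `r` of the initial Θ-data `D`: **`exists_symm_slotContentFamily_tThetaM`** — a capsule-SYMMETRIC content family
  `m` of the slot unions at `(i+1, u)` (the hypotheses `hm`/`hsub` of abc-iut-s2-p8's unit P6-instA and of this seat's generic
  `Cor312Vol.thetaLocal_untopD_le_sum_content_hull`, p437184), and **`sum_weightM_content_eq_orbitSumM`** — for any content family,
  `Σ_{v⃗'} weightM·(−m(v⃗')·log p_u + log μ̄(hull(log_p R^×_{v⃗'}))) = orbitSumM D r i u` (abc-iut-w5-d166's orbit sum, unit P6-final p438195,
  whose procession average IS abc-iut-S2's `negLogThetaLoc p_u`, unit P6-ident p437565) — stated for ANY `Fintype` instance on the fibre.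
So unit P6-instC reads: `hA := (instA m hm hsub) ▸ sum_weightM_content_eq_orbitSumM ▸ thetaLocal_le_coe_of_untopD_le`.
[cite: Mochizuki2012, IUTchIV Thm. 1.10 Step (v) p. 27–28] [cite: DupuyHilado2025, §4.7, §4.9, §4.12]
[cite: WeilBNT1967, Ch. II §2, Th. 2] [claim: Mochizuki2012, status: disputed] for the quoted constructions.
HONEST FRAMING: lattice bookkeeping about OUR typed packets; nothing here bears on the truth of [IUTchIII] Cor. 3.12;
typed ≠ proved; instantiated ≠ endorsed.
-/

noncomputable section

open Set Function NumberField IsDedekindDomain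
open scoped Pointwise

/-! ## §1. Generic packet algebra: the content of a slot union and its (Ind1)-symmetry -/

namespace Summit.ABC.IUTFork.Cor312Vol

open Literature.IUT.LogVolume

section Generic

variable (p : ℕ) [hp : Fact p.Prime] {I : Type} [Fintype I] [DecidableEq I] [Nonempty I]
  (k : I → Type) [∀ i, NontriviallyNormedField (k i)] [∀ i, NormedAlgebra ℚ_[p] (k i)]
  [∀ i, IsUltrametricDist (k i)] [∀ i, ProperSpace (k i)]

/-- **The slot union `⋃_a ι_a(x_a)·(R_I)^∼` of a family of NONZERO slot scalars has a content**: there is `m ∈ ℤ` with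
`⋃_a ι_a(x_a)·(R_I)^∼ ⊆ p^m·log_p(R_I^×)` and `⊄ p^{m+1}·log_p(R_I^×)` (it is bounded — abc-iut-S8
`isPsiBounded_smul_normalizedPacket` — and contains the nonzero `ι_a(x_a)·1`; abc-iut-w5-d180 `exists_content`).
[cite: WeilBNT1967, Ch. II §2, Th. 2] [cite: DupuyHilado2025, §4.12] -/
theorem exists_content_slotUnion (x : ∀ a, k a) (hx : ∀ a, x a ≠ 0) :
    ∃ m : ℤ, (⋃ a, iota p k a (x a) • (normalizedPacket p k : Set (PacketAlgebra p k))) ⊆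
        ((p : ℚ_[p]) ^ m) • (logPacket p k : Set (PacketAlgebra p k)) ∧
      ¬ (⋃ a, iota p k a (x a) • (normalizedPacket p k : Set (PacketAlgebra p k))) ⊆
        ((p : ℚ_[p]) ^ (m + 1)) • (logPacket p k : Set (PacketAlgebra p k)) := by
  refine exists_content p k (isPsiBounded_iUnion p k fun a => isPsiBounded_smul_normalizedPacket p k _) ?_
  obtain ⟨a⟩ := ‹Nonempty I›
  refine ⟨iota p k a (x a), Set.mem_iUnion.mpr ⟨a, ?_⟩, (map_ne_zero (iota p k a)).mpr (hx a)⟩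
  have h := Set.smul_mem_smul_set (a := iota p k a (x a))
    (show (1 : PacketAlgebra p k) ∈ (normalizedPacket p k : Set (PacketAlgebra p k)) from Subring.one_mem _)
  rwa [smul_eq_mul, mul_one] at h

/-- **The log-volume of the orbit hull of the slot union in terms of its content**: if `m` is the content of
`M = ⋃_a ι_a(x_a)·(R_I)^∼` then `log μ̄(hull(⋃_{g ∈ Ind2} g·M)) = −m·log p + log μ̄(hull(log_p(R_I^×)))` (abc-iut-w5-d180
`packetLogμ_packetHull_orbit_eq`). [cite: DupuyHilado2025, §4.9, §4.12] [cite: Mochizuki2012, IUTchIV Thm. 1.10 Step (v) p. 27–28] -/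
theorem packetLogμ_packetHull_orbit_slotUnion_eq (x : ∀ a, k a) {m : ℤ}
    (hm : (⋃ a, iota p k a (x a) • (normalizedPacket p k : Set (PacketAlgebra p k))) ⊆
      ((p : ℚ_[p]) ^ m) • (logPacket p k : Set (PacketAlgebra p k)))
    (hm1 : ¬ (⋃ a, iota p k a (x a) • (normalizedPacket p k : Set (PacketAlgebra p k))) ⊆
      ((p : ℚ_[p]) ^ (m + 1)) • (logPacket p k : Set (PacketAlgebra p k))) :
    packetLogμ p k (packetHull p k (⋃ g : indTwo p k,
        g • ⋃ a, iota p k a (x a) • (normalizedPacket p k : Set (PacketAlgebra p k)))) =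
      -(m * Real.log p) + packetLogμ p k (packetHull p k (logPacket p k : Set (PacketAlgebra p k))) := by
  obtain ⟨y, hyM, hy⟩ := Set.not_subset.mp hm1
  exact (packetLogμ_packetHull_orbit_eq p k hyM hy hm).2

omit [Fintype I] [Nonempty I] [∀ i, IsUltrametricDist (k i)] [∀ i, ProperSpace (k i)] in
/-- The (Ind1)-transport of a slot union: the factor permutation `perm_σ : ⊗_c k_{σ c} ≃ ⊗_b k_b` carries the slot union of
the permuted family `(x_{σ c})_c` ONTO the slot union of `x` (slot `c` goes to slot `σ(c)`, abc-iut-S8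
`image_permAlgEquiv_iota_smul_normalizedPacket`). [cite: DupuyHilado2025, §4.7] -/
theorem image_permAlgEquiv_slotUnion [Fintype I] [Nonempty I] [∀ i, IsUltrametricDist (k i)] [∀ i, ProperSpace (k i)]
    (σ : Equiv.Perm I) (x : ∀ a, k a) :
    permAlgEquiv p k σ '' (⋃ c, iota p (fun c => k (σ c)) c (x (σ c)) •
        (normalizedPacket p (fun c => k (σ c)) : Set (PacketAlgebra p (fun c => k (σ c))))) =
      ⋃ a, iota p k a (x a) • (normalizedPacket p k : Set (PacketAlgebra p k)) := by
  rw [Set.image_iUnion]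
  apply Set.Subset.antisymm
  · refine Set.iUnion_subset fun c => ?_
    rw [image_permAlgEquiv_iota_smul_normalizedPacket]
    exact Set.subset_iUnion (fun a => iota p k a (x a) • (normalizedPacket p k : Set (PacketAlgebra p k))) (σ c)
  · refine Set.iUnion_subset fun a => ?_
    obtain ⟨c, rfl⟩ := σ.surjective a
    refine le_trans (le_of_eq ?_) (Set.subset_iUnion _ c)
    rw [image_permAlgEquiv_iota_smul_normalizedPacket]

omit [Nonempty I] in
/-- **(Ind1)-SYMMETRY OF THE CONTENT**: the slot union of the permuted family `(k∘σ, x∘σ)` and the slot union of `(k, x)` have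
the SAME content (transport the two inclusions along `perm_σ`, which maps `p^m·log_p(R^×_{k∘σ})` onto `p^m·log_p(R^×_k)` —
abc-iut-S1 `image_logPacket_perm` — and conclude by abc-iut-w5-d180's `content_unique`). [cite: DupuyHilado2025, §4.7, §4.12] -/
theorem content_slotUnion_perm [Nonempty I] (σ : Equiv.Perm I) (x : ∀ a, k a) {m m' : ℤ}
    (hm : (⋃ c, iota p (fun c => k (σ c)) c (x (σ c)) •
        (normalizedPacket p (fun c => k (σ c)) : Set (PacketAlgebra p (fun c => k (σ c))))) ⊆
      ((p : ℚ_[p]) ^ m) • (logPacket p (fun c => k (σ c)) : Set (PacketAlgebra p (fun c => k (σ c)))))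
    (hm1 : ¬ (⋃ c, iota p (fun c => k (σ c)) c (x (σ c)) •
        (normalizedPacket p (fun c => k (σ c)) : Set (PacketAlgebra p (fun c => k (σ c))))) ⊆
      ((p : ℚ_[p]) ^ (m + 1)) • (logPacket p (fun c => k (σ c)) : Set (PacketAlgebra p (fun c => k (σ c)))))
    (hm' : (⋃ a, iota p k a (x a) • (normalizedPacket p k : Set (PacketAlgebra p k))) ⊆
      ((p : ℚ_[p]) ^ m') • (logPacket p k : Set (PacketAlgebra p k)))
    (hm1' : ¬ (⋃ a, iota p k a (x a) • (normalizedPacket p k : Set (PacketAlgebra p k))) ⊆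
      ((p : ℚ_[p]) ^ (m' + 1)) • (logPacket p k : Set (PacketAlgebra p k))) :
    m = m' := by
  -- transport the content conditions of the permuted slot union along `perm_σ`
  have hinj : Function.Injective (permAlgEquiv p k σ) := (permAlgEquiv p k σ).injective
  have htr : ∀ n : ℤ, ((⋃ c, iota p (fun c => k (σ c)) c (x (σ c)) •
        (normalizedPacket p (fun c => k (σ c)) : Set (PacketAlgebra p (fun c => k (σ c))))) ⊆
      ((p : ℚ_[p]) ^ n) • (logPacket p (fun c => k (σ c)) : Set (PacketAlgebra p (fun c => k (σ c))))) ↔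
      (⋃ a, iota p k a (x a) • (normalizedPacket p k : Set (PacketAlgebra p k))) ⊆
        ((p : ℚ_[p]) ^ n) • (logPacket p k : Set (PacketAlgebra p k)) := by
    intro n
    rw [← Set.image_subset_image_iff hinj, image_permAlgEquiv_slotUnion, image_const_smul_perm, image_logPacket_perm]
  exact content_unique p k ((htr m).mp hm) (fun h => hm1 ((htr (m + 1)).mpr h)) hm' hm1'

end Generic

end Summit.ABC.IUTFork.Cor312Vol

/-! ## §2. At the M-level presentation: the symmetric content family of the Θ-slot unions and the orbit-sum identity -/

namespace Summit.ABC.IUTFork.Thm311.Real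

open Cor312 Cor312Vol Literature.IUT.LogThetaLattice Literature.IUT.LogVolume Literature.IUT.HodgeTheaters
  Literature.NumberTheory.NumberFields

variable {F K Fbar : Type} [Field F] [NumberField F] [Field K] [NumberField K] [Algebra F K]
  [Field Fbar] [Algebra F Fbar] [Algebra K Fbar] {E : WeierstrassCurve F} [E.IsElliptic] {l : ℕ}
  {Pb : BadPlacePredicates K} (D : InitialThetaData F K Fbar E l Pb) (r : ThetaData.IdeleData D)

/-- **A capsule-SYMMETRIC content family of the Θ-slot unions at `(i+1, u)`**: for every tuple `v⃗' : S^±_{i+2} → V̲_u` the slot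
union `⋃_a ι_a(t_{Θ,i,v̲'_a})·(R_I)^∼` over unit P1's fields `kOfM` with unit P4a's Θ-ideles `tThetaM` (units, `tThetaM_ne_zero`) has
a content `m(v⃗')`, and `m(v⃗'∘σ) = m(v⃗')` for every capsule permutation `σ` (§1). These are the hypotheses `hm`/`hsub` of the
setting-side content bound (unit P6-instA / this seat's `Cor312Vol.thetaLocal_untopD_le_sum_content_hull`).
[cite: WeilBNT1967, Ch. II §2, Th. 2] [cite: DupuyHilado2025, §4.7, §4.12] -/
theorem exists_symm_slotContentFamily_tThetaM (i : Fin (thetaIndexOfInitial D).lstar) (u : FinitePlace ℚ) :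
    ∃ m : (Fin ((i : ℕ) + 1 + 1) → (thetaIndexOfInitial D).Fibre (Val.non u)) → ℤ,
      (∀ (σ : Equiv.Perm (Fin ((i : ℕ) + 1 + 1)))
        (e' : Fin ((i : ℕ) + 1 + 1) → (thetaIndexOfInitial D).Fibre (Val.non u)), m (e' ∘ σ) = m e') ∧
      ∀ e' : Fin ((i : ℕ) + 1 + 1) → (thetaIndexOfInitial D).Fibre (Val.non u),
        (⋃ a : Fin ((i : ℕ) + 1 + 1),
            iota (ratChar u) (fun b => kOfM D (ratChar u) u (natCast_ratChar_mem u) (e' b)) a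
                (tThetaM D (ratChar u) u (natCast_ratChar_mem u) r i (e' a)) •
              (normalizedPacket (ratChar u) (fun b => kOfM D (ratChar u) u (natCast_ratChar_mem u) (e' b)) :
                Set (PacketAlgebra (ratChar u) (fun b => kOfM D (ratChar u) u (natCast_ratChar_mem u) (e' b))))) ⊆
          (((ratChar u : ℕ) : ℚ_[ratChar u]) ^ m e') •
            (logPacket (ratChar u) (fun b => kOfM D (ratChar u) u (natCast_ratChar_mem u) (e' b)) :
              Set (PacketAlgebra (ratChar u) (fun b => kOfM D (ratChar u) u (natCast_ratChar_mem u) (e' b)))) ∧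
        ¬ (⋃ a : Fin ((i : ℕ) + 1 + 1),
            iota (ratChar u) (fun b => kOfM D (ratChar u) u (natCast_ratChar_mem u) (e' b)) a
                (tThetaM D (ratChar u) u (natCast_ratChar_mem u) r i (e' a)) •
              (normalizedPacket (ratChar u) (fun b => kOfM D (ratChar u) u (natCast_ratChar_mem u) (e' b)) :
                Set (PacketAlgebra (ratChar u) (fun b => kOfM D (ratChar u) u (natCast_ratChar_mem u) (e' b))))) ⊆
          (((ratChar u : ℕ) : ℚ_[ratChar u]) ^ (m e' + 1)) •
            (logPacket (ratChar u) (fun b => kOfM D (ratChar u) u (natCast_ratChar_mem u) (e' b)) :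
              Set (PacketAlgebra (ratChar u) (fun b => kOfM D (ratChar u) u (natCast_ratChar_mem u) (e' b)))) := by
  -- the content at each tuple (§1), chosen
  have h := fun e' : Fin ((i : ℕ) + 1 + 1) → (thetaIndexOfInitial D).Fibre (Val.non u) =>
    exists_content_slotUnion (ratChar u) (fun b => kOfM D (ratChar u) u (natCast_ratChar_mem u) (e' b))
      (fun a => tThetaM D (ratChar u) u (natCast_ratChar_mem u) r i (e' a))
      (fun a => tThetaM_ne_zero D (ratChar u) u (natCast_ratChar_mem u) r i (e' a))
  choose m hm hm1 using h
  refine ⟨m, fun σ e' => ?_, fun e' => ⟨hm e', hm1 e'⟩⟩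
  -- symmetry: the family at `v⃗'∘σ` IS the permuted family of the family at `v⃗'` (definitionally), §1
  exact content_slotUnion_perm (ratChar u) (fun b => kOfM D (ratChar u) u (natCast_ratChar_mem u) (e' b)) σ
    (fun a => tThetaM D (ratChar u) u (natCast_ratChar_mem u) r i (e' a)) (hm (e' ∘ σ)) (hm1 (e' ∘ σ)) (hm e') (hm1 e')

/-- **THE ORBIT-SUM IDENTITY**: for ANY content family `m` of the Θ-slot unions at `(i+1, u)`,
`Σ_{v⃗'} weightM(v⃗')·(−m(v⃗')·log p_u + log μ̄_{v⃗'}(hull(log_p(R^×_{v⃗'})))) = orbitSumM D r i u` — abc-iut-w5-d166's orbit sum (unit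
P6-final, p438195: `Σ_{v⃗'} Pr(v⃗')·log μ̄(hull of the (Ind2)-orbit of the slot union)`), whose procession average is abc-iut-S2's
`negLogThetaLoc p_u` (unit P6-ident). Stated for ANY `Fintype` instance on the fibre (the orbit sum carries `Fintype.ofFinite`).
[cite: DupuyHilado2025, Def. 3.6.3, §4.11–4.12] [cite: Mochizuki2012, IUTchIV Thm. 1.10 Step (v) p. 27–28] -/
theorem sum_weightM_content_eq_orbitSumM (i : Fin (thetaIndexOfInitial D).lstar) (u : FinitePlace ℚ)
    [inst : Fintype ((thetaIndexOfInitial D).Fibre (Val.non u))]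
    (m : (Fin ((i : ℕ) + 1 + 1) → (thetaIndexOfInitial D).Fibre (Val.non u)) → ℤ)
    (hm : ∀ e' : Fin ((i : ℕ) + 1 + 1) → (thetaIndexOfInitial D).Fibre (Val.non u),
        (⋃ a : Fin ((i : ℕ) + 1 + 1),
            iota (ratChar u) (fun b => kOfM D (ratChar u) u (natCast_ratChar_mem u) (e' b)) a
                (tThetaM D (ratChar u) u (natCast_ratChar_mem u) r i (e' a)) •
              (normalizedPacket (ratChar u) (fun b => kOfM D (ratChar u) u (natCast_ratChar_mem u) (e' b)) :
                Set (PacketAlgebra (ratChar u) (fun b => kOfM D (ratChar u) u (natCast_ratChar_mem u) (e' b))))) ⊆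
          (((ratChar u : ℕ) : ℚ_[ratChar u]) ^ m e') •
            (logPacket (ratChar u) (fun b => kOfM D (ratChar u) u (natCast_ratChar_mem u) (e' b)) :
              Set (PacketAlgebra (ratChar u) (fun b => kOfM D (ratChar u) u (natCast_ratChar_mem u) (e' b)))) ∧
        ¬ (⋃ a : Fin ((i : ℕ) + 1 + 1),
            iota (ratChar u) (fun b => kOfM D (ratChar u) u (natCast_ratChar_mem u) (e' b)) a
                (tThetaM D (ratChar u) u (natCast_ratChar_mem u) r i (e' a)) •
              (normalizedPacket (ratChar u) (fun b => kOfM D (ratChar u) u (natCast_ratChar_mem u) (e' b)) :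
                Set (PacketAlgebra (ratChar u) (fun b => kOfM D (ratChar u) u (natCast_ratChar_mem u) (e' b))))) ⊆
          (((ratChar u : ℕ) : ℚ_[ratChar u]) ^ (m e' + 1)) •
            (logPacket (ratChar u) (fun b => kOfM D (ratChar u) u (natCast_ratChar_mem u) (e' b)) :
              Set (PacketAlgebra (ratChar u) (fun b => kOfM D (ratChar u) u (natCast_ratChar_mem u) (e' b))))) :
    ∑ e' : Fin ((i : ℕ) + 1 + 1) → (thetaIndexOfInitial D).Fibre (Val.non u),
        weightM D u (Fin.succ i) e' * (-(m e' * Real.log (ratChar u)) +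
          packetLogμ (ratChar u) (fun b => kOfM D (ratChar u) u (natCast_ratChar_mem u) (e' b))
            (packetHull (ratChar u) (fun b => kOfM D (ratChar u) u (natCast_ratChar_mem u) (e' b))
              (logPacket (ratChar u) (fun b => kOfM D (ratChar u) u (natCast_ratChar_mem u) (e' b)) :
                Set (PacketAlgebra (ratChar u) (fun b => kOfM D (ratChar u) u (natCast_ratChar_mem u) (e' b)))))) =
      orbitSumM D r i u := by
  -- the orbit sum carries `Fintype.ofFinite`; any two `Fintype` structures on the fibre coincide
  have hinst : inst = Fintype.ofFinite _ := Subsingleton.elim _ _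
  subst hinst
  unfold orbitSumM
  refine Finset.sum_congr rfl fun e' _ => congrArg (weightM D u (Fin.succ i) e' * ·) ?_
  exact (packetLogμ_packetHull_orbit_slotUnion_eq (ratChar u)
    (fun b => kOfM D (ratChar u) u (natCast_ratChar_mem u) (e' b))
    (fun a => tThetaM D (ratChar u) u (natCast_ratChar_mem u) r i (e' a)) (hm e').1 (hm e').2).symm

end Summit.ABC.IUTFork.Thm311.Real

end
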